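import Mathlib
import Summits.Langlands.Langlands.Theses.PicardMuOrdinary
import Summits.Langlands.Langlands.Theorems.PicardMuOrdinaryIrregularClassicalityDefs
import Literature.NumberTheory.GaloisRepresentations.CubicResidueSymbol
import Literature.NumberTheory.GaloisRepresentations.GaloisRep
import Literature.NumberTheory.Automorphic.ReciprocityGLnProofs
import Literature.NumberTheory.Automorphic.AsaiSign
import Summits.Langlands.Langlands.Theorems.PicardMuOrdinaryIrregularClassicalityPlaceOfMaximalIdeal
import Literature.NumberTheory.GaloisRepresentations.PicardCurveGaloisRep
import Literature.NumberTheory.Automorphic.BaseChangeCyclicCuspidal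
import Literature.NumberTheory.Automorphic.BaseChangeStrongUnramified
import Literature.NumberTheory.Automorphic.BaseChangeArchimedean
import Summits.Langlands.Langlands.Theorems.PicardMuOrdinaryIrregularClassicalityTwistedPicardGaloisInput
import Summits.Langlands.Langlands.Theorems.PicardMuOrdinaryIrregularClassicalityBaseChangeToLLinked
import Summits.Langlands.Langlands.Theorems.PicardMuOrdinaryIrregularClassicalityIrregularDescentUntwist
import Literature.NumberTheory.GaloisRepresentations.OrdinaryRegular
import Literature.NumberTheory.GaloisRepresentations.LocalClassFieldTheory

/-!
# Line `split-ramified-prime-sqrt6` — checked skeleton for the crux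
`Summit.Langlands.Langlands.Theses.PicardMuOrdinary.IrregularClassicality` (stmt-Langlands-13758)

Planner crux-plan (round 1), idea card `Cruxes/IrregularClassicality/Ideas/split-ramified-prime-sqrt6.md`,
triage `TRIAGE-r1-{1,2,3}.md` (pass ×3).  Seven registered stubs `stub_*` (sorried; each a genuine
lemma of the line) and the kernel-checked composition
`IrregularClassicality_of : IrregularClassicality` (pure logic; the only `sorry`s are inside the
stubs).  See `Lines/split-ramified-prime-sqrt6.md` for the line card.

Notation in comments: `K = ℚ(ω) = CyclotomicField 3 ℚ`, `λ = (1 - ω)` its prime above `3`,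
`ℤ̄ = integralClosure ℤ ℂ`, `ℚ̄₃ = PadicAlgCl 3`, `a_𝔭(f) = picardTrace f 𝔭`, `ϖ_𝔭 ∈ 𝓞_K` the PRIMARY
generator of a prime `𝔭 ∤ 3` (`𝔭 = (ϖ_𝔭)`, `ϖ_𝔭 ≡ 1 mod 3`; unique: `𝓞_K` is a PID and its six units are
distinct modulo `3 = -ω²λ²`), `ψ` the algebraic Hecke character of `K` of conductor `(3)` and
infinity type `(1,0)` with `ψ((α)) = α` for `α ≡ 1 mod 3` (so `ψ(𝔭) = ϖ_𝔭`, `ψ ψ^c = N`),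
`ρ_C = V_e : Γ_K → GL₃(ℚ̄₃)` the `λ`-adic representation of the Picard curve `C : y³ = f(x)` read
through `(ι, e)` (geometric Frobenius trace `ι⁻¹ e(a_𝔭 f)`), and
`ρ'_C = ρ_C ⊗ ψ` its CM TWIST (geometric Frobenius trace `ι⁻¹ e(a_𝔭(f)·ϖ_𝔭)`).
`L = K(√-2) = ℚ(√-3, √-2) = K(√6)` (since `√6·√-3 = 3√-2`), `L⁺ = ℚ(√6)`, `c ∈ Gal(L/ℚ)` the
involution with fixed field `L⁺` (it restricts to complex conjugation `c₀` of `K` and sends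
`√-2 ↦ -√-2`), `u, ū` the two primes of `L` above `λ` (`L_u = K_λ = ℚ₃(√-3) = ℚ₃(√6)`: `-2 ≡ 1 mod 3`
is a `3`-adic square), `G' = U(2,1)_{L/L⁺}`, whose Shimura variety is a unitary FOURFOLD with
`G'(ℚ₃) = GL₃(K_λ)`.

WHY THE TWIST (planner's parity check, NOTES.md §Parity): `ρ_C` is polarized with an ODD
multiplier, `ρ_C^{c₀} ≅ ρ_C^∨ ⊗ ε^{-1}` (Weil pairing + `ℤ[ω]`-action; `det ρ_C · (det ρ_C)^{c₀} = ε^{-3}`,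
motivic weight `1`, rank `3`), whereas the Galois representation of a regular algebraic cuspidal `Π`
on `GL₃(𝔸_K)` with `Π^{c₀} ≅ Π^∨` EXACTLY (the tree's `IsConjSelfDualAE c₀`) has the EVEN multiplier
`ε^{-2}` (`det r · (det r)^{c₀} = ε^{-6}`).  Since `ε³ ≢ 1 mod 27` on `Γ_K`, no such `Π` can have
`N𝔭·ΣSat(Π,𝔭) ≡ e(a_𝔭 f)` modulo `3^k ℤ̄_𝔐` for `k ≥ 4`: an exactly polarized tower must approximate the
TWIST `ρ'_C = ρ_C ⊗ ψ` (multiplier `ε^{-2}`, weights `{1,1,2} | {0,1,1}` — the object that actually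
lives on the unitary Shimura varieties), i.e. the traces `a_𝔭(f)·ϖ_𝔭`.  The polarized towers below
are therefore `ψ`-TWISTED, and the untwist `π'_K ↦ π'_K ⊗ ψ^{-1}` is part of the descent stub.  (The
restate "add `IsConjSelfDualAE` to the `P_k` of 13757/13758" requested by the triage would, taken
literally, make 13757's conclusion unsatisfiable — see the line card, Triage answers.)

THE LEVER (card): the one-line field change `K ↦ L` converts the crux's local type at `3` from the
ramified unitary (AR) case (reducible Pappas–Rapoport fibre, μ-ordinary locus not dense, anisotropic
degree-1 cell) to the SPLIT case (smooth μ-ordinary-dense splitting model, Borel/two-`U`-operator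
Hida theory, both degree-1 Cousin targets `(1,0′), (0,1′)` meeting the μ-ordinary locus — the
incident-pair census checked by all three triagers), WITHOUT changing the local Galois
representation (`L_u = K_λ`).  There the ordinary irregular-weight classicality of BCGP 2025
(higher Hida in degrees `0,1`, `p`-adic Eichler–Shimura, Sen = Cousin) is run with TWO walls
(weight `((1,1,1),(1,1,1))`, one μ-ordinary projector, two Sen operators) — BCGP's announced open
extension "`p` arbitrary in the totally real field" with `e = 2` (arXiv:2502.20645 p. 3) — and the
irregular automorphy is DESCENDED `L → K` by Arthur–Clozel for `GL₃` (weight-blind) plus a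
Goldring–Koskivirta sign check at the primes inert in `L/K`, and untwisted by `ψ^{-1}`.

Shape of the line (Galois currency between stubs, as in the sibling line
`Cruxes/MuOrdinaryFamilyRT/Lines/weight-blind-lambda-adic-rt.lean`, whose `F' = K(√6)` IS our `L`):
* `stub_placeOfMaximalIdeal` — every maximal `𝔐 ∋ 3` of `ℤ̄ ⊂ ℂ` is the place of an isomorphism
  `ι : ℚ̄₃ ≃ ℂ`: `v_𝔐(z) ≥ k ⇒ ‖ι⁻¹ z‖ ≤ 3^{-k}` (Steinitz + conjugacy of extensions of `|·|₃` to
  `ℚ̄`; pure algebra, provable now; the converse dictionary of the sibling's `stub_dictionary`).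
* `stub_twistedPicardGaloisInput` — the primary generators `ϖ` off a finite `S₀ ⊇ {v ∣ 3}` and the
  twisted Picard representation `ρ'_C` through `(ι, e)`: unramified outside `S₀`, geometric Frobenius
  trace `ι⁻¹ e(a_𝔭(f)·ϖ_𝔭)`, absolutely irreducible on `Γ_L` for EVERY quadratic `L/K` (`A₄` has no
  subgroup of index `2`).  The sibling's Stub A, twisted by the CM character.
* `stub_polarizedTwistedTower` — THE INTERFACE DEBT (Disproof item 7/17(a), triage F1 ×3), in its
  CORRECT (twisted) form: from the typed tower for `a_𝔭(f)`, an exactly conjugate-self-dual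
  (`IsConjSelfDualAE c₀`) regular cuspidal tower for `a_𝔭(f)·ϖ_𝔭`.  NOT to be staffed: it is what
  every intended tower of 13757 is before untwisting, and it is discharged by restating the
  13757 → 13758 interface in this twisted-polarized normal form; before that it is a polarized
  `R = T`-sized statement (13757-hard).
* `stub_baseChangeToL` — Arthur–Clozel base change of a polarized tower to `L = K(√-2)`, in
  GALOIS-CONVERGENT form (general target function `a`, general `ρ`): constructs
  `(L, s = √-2, c, hcptL, S_L)` and, for every `k`, a regular algebraic conjugate-self-dual cuspidal
  `Π_k` on `GL₃(𝔸_L)` unramified outside `S_L` with its HLTT representation `r_k` (lang.S27) and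
  `‖tr r_k − tr ρ|_{Γ_L}‖ ≤ 3^{-k}` on `Γ_L` (Chebotarev density of degree-one Frobenii + continuity +
  the place dictionary).  Known-results assembly.
* `stub_twoWallOrdinaryClassicality` — THE HEART (card K1 + K2 + K3(a); hardest): for μ-ordinary
  generic `f`, `ρ'_C|_{Γ_L}` a limit of polarized regular cuspidal `Π_k` ⇒ `ρ'_C|_{Γ_L}` is automorphic:
  cuspidal L-algebraic `π'_L` on `GL₃(𝔸_L)` with full Frobenius compatibility a.e.
  (`arithFrobPolyOfSatake ι q 1 β`).  Inside: (i) μ-ordinary REALIZATION of `λ'_{C,L}` in the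
  μ-ordinary higher-Hida `H⁰` of weight `((1,1,1),(1,1,1))` (up to the twist) of the fourfold (needs an
  ORDINARY AVATAR of the slope-free typed tower — second half of the interface debt — and typicity
  via BCGP Lemma 276, triage F3); (ii) TWO-WALL ORDINARY SEN = COUSIN for `Res_{K_λ/ℚ₃} GL₃`,
  `μ = ((1,0,0),(1,1,0))`, one μ-ordinary projector, Sen components `Θ_{σ₁}, Θ_{σ₂}`, Cousin maps into
  the incident cells `(1,0′), (0,1′)` (triage-2 sharpening; load-bearing, BCGP's open extension);
  (iii) multiplicity one (K3(a)); (iv) transfer `G' → GL₃/L` (Rogawski/Mok) of the classical form,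
  whose eigensystem gives the Frobenius compatibility at split AND inert places.
* `stub_irregularDescentUntwist` — weight-blind cyclic descent `L → K` of the irregular `π'_L`
  (Arthur–Clozel Thm. III.4.2 (d); Satake multisets Galois-stable by the compatibility with
  `ρ'_C|_{Γ_L}`), the twist/sign ambiguity at primes inert in `L/K` pinned by the Goldring–Koskivirta
  pseudo-representation of the descended limit-of-discrete-series form on `GU(2,1)_{K/ℚ}` compared
  with `ρ'_C` over `L` (Chebotarev + Brauer–Nesbitt + Clifford), then the untwist by the automorphic
  CM character `ψ^{-1}`: output in the crux's SUM form `Σ Satake(π_K, 𝔭) = e(a_𝔭 f)` a.e.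
* RESHAPE r2 (lead prover-line-stmt-Langlands-13758-0, 2026-08-16, after the parallel drefute
  seats' findings `DrefuteVacuity-…`, `DrefuteNote-stub-{polarizedTwistedTower,
  twoWallOrdinaryClassicality,nonMuOrdinaryRemainder}.md`, `DrefuteG2-RepairCheck-…` in this
  directory): the planner's case split on `HasMuOrdinaryReductionAtThree f` (definition D1:
  potentially good reduction of the CURVE with `3`-rank `2`) is EMPTY on `ℤ[X]` — Börner–Bouw–Wewers
  2017 (arXiv:1701.01986 §3.2, Lemma 4 with Lemma 3): over an absolutely unramified `3`-adic field a
  Picard curve with potentially good reduction reduces to the ONE-branch-point curve `y³ − y = x⁴`,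
  of `3`-rank `0`.  So Stubs 3 and 5 were vacuous and the former Stub 7 (the negated predicate
  implies the crux) WAS the crux verbatim (a costume).  The split is therefore REMOVED: Stubs 3 and
  5 are now stated for every generic `f`, Stub 7 is deleted, and `IrregularClassicality_of` is the
  linear chain 1 → 2 → 3 → 4 → 5 → 6.  The honest re-split of Stub 5 into "μ-ordinary-JACOBIAN
  engine" + "conceded remainder" needs the repaired predicate
  `HasMuOrdinaryJacobianReductionAtThree f` (J(C_f) potentially good of `3`-rank `2` = BBW type (b),
  WITHOUT the `Nodup` clause; non-empty: `f_b = 3x⁴ + x³ − 54`, `S₄`, BBW Ex. 2 — drefute g2 §2–3),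
  a definition the tree does not have yet (definition request recorded in the lead's NOTES/Census;
  planner's restate).  Until then the remainder (λ-basic Jacobian — which by BBW includes EVERY
  admissible `f` whose CURVE has potentially good reduction, e.g. the CM anchor `f₆₇` — and the
  potentially multiplicative types (c)–(e)) lives inside Stub 5's domain, where no ordinary engine
  applies; Stub 5 is TRUE there all the same (it is implied by reciprocity, Disproof item 2).

* RESHAPE r6 (continuation lead prover-line-stmt-Langlands-13758-c1-0, 2026-08-16, after lead-1's restate
  verdict `Lines/split_ramified_prime_sqrt6_restated.lean` and this lead's ordinary restate
  `Lines/split_ramified_prime_sqrt6_restated_ord.lean`): the heart is split ALONG THE GALOIS-SIDE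
  μ-ORDINARITY GUARD of drefute g3 (`MuOrdinaryGaloisGuard art A B ι e ρ`: `ρ = ρ'_C` ordinary at `λ` of
  the labelled weight `A | B` relative to a local Artin datum `art` — typed, non-empty (BBW type (b),
  `f = 3x⁴ + x³ − 54`), fails on the λ-basic class) and the ORDINARY AVATAR is made explicit:
  `stub_ordinaryPolarizedTwistedTower` (interface debt, guarded: typed tower + guard ⇒ ORDINARY exactly
  polarized tower for the twisted traces, members Galois-compatible off `S'` with `r_k` ordinary at `λ`;
  = what 13757's `R^{μ-ord} = T` lines deliver; discharged by the planner's ordinary restate of BOTH items),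
  `stub_twoWallOrdinaryClassicalityOrd` (the heart in honest form: guard + `K`-side ordinary avatars among
  the hypotheses = BCGP 2025's announced extension for this datum, the ONE open theorem), and
  `stub_basicRemainder` (the conceded λ-basic class: `ρ` ordinary for NO Artin datum and NO labelled
  weight ⇒ the `K`-side automorphy conclusion from the typed tower alone; crux-sized, no mechanism in
  print — under the ordinary restate it leaves this item and becomes the guard hypothesis of 13757 / a
  third branch of the route).  Composition: Stubs 1, 2, then `by_cases ∃ art A B, guard`; yes ⇒ 3ᵒʳᵈ ⇒ 4
  (over the place ideal `𝔐_ι` of the 13757 dictionary) ⇒ 5ᵒʳᵈ ⇒ 6; no ⇒ 5rem ⇒ 6.  Five sorried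
  stubs (2⁰, 4⁰ named facts; 3ᵒʳᵈ interface; 5ᵒʳᵈ heart; 5rem remainder), `stubs_max = 7`.

* RESHAPE r7 (continuation lead prover-line-stmt-Langlands-13758-c2-0, 2026-08-16): THE GUARD IS ALIGNED.
  Finding: the r6 guard `∃ A B, ρ.IsOrdinaryOfLabelledWeightAt λ (art λ) (labelWeight ι e λ A B)` only
  says "`ρ|_{Γ_{K_λ}}` is triangulable with locally algebraic diagonal (up to finite order on inertia)" —
  the tree's `IsOrdinaryOfLabelledWeight` carries no slope, dominance or polarization clause and `A, B`
  were free — so it HOLDS at the split-basic CM anchor `f₆₇` (Disproof item 20: `ρ_C ≅ Ind_{Γ_M}^{Γ_K} Ψ`,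
  `λ` totally split in `M/K`, complex conjugation in every decomposition group above `3`, hence
  `ρ'_C|_{Γ_{K_λ}} = Ψ'_{w₁} ⊕ Ψ'_{w₂} ⊕ Ψ'_{w₃}`, three de Rham characters), contrary to what drefute g3,
  r6 and both restate verdicts assert ("fails on the λ-basic class, e.g. `f₆₇`").  Under the proposed
  re-route (`MuOrdinaryGaloisGuard` as HYPOTHESIS of 13757ᵒʳᵈ) `f₆₇` would therefore be filed with the
  μ-ordinary ENGINE, which has nothing to say there: an algebraic Hecke character of the CM field `M` has
  `n_σ + n_{σc}` constant, so at each `w_i ∣ λ` (`M_{w_i} = K_λ`, the two labels of `K_λ` being `σ_i` and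
  `σ_i c`) the characters `Ψ'_{w_i}` have labelled weights `(n_i | w - n_i)` — ANTI-aligned — and no ordering
  of the three rows is weakly monotone at both labels; every CM tower through `ρ'_{C₆₇}` is anti-aligned
  likewise, whereas the avatars of `OrdPolarizedTower` are ordinary of DOMINANT (= strictly aligned,
  `LabelledWeight.IsDominant.strictMono`) weight.  Repair (this reshape): the guard asks for an ALIGNED
  weight — `IsAlignedWeight wt : ∀ τ, Monotone (i ↦ wt τ i.rev + i)`, the closure of the tree's dominance
  — and becomes `MuOrdinaryGaloisGuard art ρ := ∃ v ∋ 3, ∃ wt, IsAlignedWeight wt ∧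
  ρ.IsOrdinaryOfLabelledWeightAt v (art v) wt` (`ι, e, A, B` gone; `labelWeight` deleted).  It holds for
  BBW types (b)–(e) (flag `mult ⊂ connected ⊂ all` resp. the monodromy flag, Hodge–Tate weights weakly
  monotone in the same direction at both labels; anchor `3x⁴ + x³ − 54`), fails for the split-basic CM
  points (proved on paper) and expectedly for the supersingular type (a) (no unit-root line), and
  dominant-ordinary representations pass it (`muOrdinaryGaloisGuard_of_isDominant`).  Signatures of 3ᵒʳᵈ, 5ᵒʳᵈ, 5rem lose
  the binders `A B`; the composition splits on `∃ art, MuOrdinaryGaloisGuard art ρ`; landed Stubs 1, 2,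
  4, 6 untouched.  The same aligned guard is what the re-route must use as 13757ᵒʳᵈ's hypothesis and,
  negated, as the hypothesis of the third branch `BasicLocusAutomorphy` (typed, with a kernel-checked
  `closes_ord`, in `Lines/split_ramified_prime_sqrt6_route_ord.lean`).  The heart 5ᵒʳᵈ drops the guard
  from its hypotheses and is now VERBATIM lead c1's `TwoWallOrdinaryClassicalityOrdStmt` — ONE canonical
  open theorem for the current composition and for the re-routed certificate `irregularClassicalityOrd_of`;
  μ-ordinarity reaches it only through the avatars it consumes, and the guard is used by 3ᵒʳᵈ alone.

* RESHAPE r8 (continuation lead prover-line-stmt-Langlands-13758-c3-0, 2026-08-16): HARRIS–LAN–TAYLOR–THORNE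
  DROPPED.  Since r6 the tower fed to the base change is the ORDINARY polarized tower of Stub 3ᵒʳᵈ, whose
  members come with framed avatars `r_k`, unramified and Galois-compatible with `Π_k` off `S'`
  (`IsGaloisCompatibleAt`, HLTT normalisation) and with the congruence in the `ι`-currency; the landed
  r5 form of Stub 4 forgot them (`tower𝔐_of_ordPolarizedTower`, place dictionary `𝔐_ι`) and re-created
  Galois representations over `K` from `exists_galoisRep_of_regularAlgebraic` (lang.S27).  The avatar
  form `stub_baseChangeToL_ord` (landed, `…BaseChangeToLOrd.lean`; registered helper of the crux item)
  base-changes the tower WITH its avatars — the `L`-side representation is `r_k|_{Γ_L}` — from the three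
  Arthur–Clozel facts alone, so `stub_baseChangeFacts` shrinks to three conjuncts and the line's lean set
  to FOUR named facts (Picard `λ`-adic representation; Arthur–Clozel III.4.2 (a), III.5.1 finite, III.5.1
  archimedean).  The `𝔐_ι` dictionary lemmas leave the skeleton (the λ-basic branch keeps the crux's own
  `𝔐`); signatures of the four open content stubs 2⁰, 3ᵒʳᵈ, 5ᵒʳᵈ, 5rem are byte-identical with r7.

* RESHAPE r9 (same lead, same day): THE HEART'S TWO TOWERS ARE LINKED.  Up to r8 the heart took the
  `K`-side ordinary tower and the `L`-side Galois-convergent tower as independent hypotheses, the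
  `L`-side representation anonymous behind an `∃` — so "`Π_k = BC(P_k)` with Galois representation
  `r_k|_{Γ_L}`, ordinary at `u, ū ∣ 3` since `L_u = K_λ`", the one fact step (i) REALIZATION of the
  intended proof rests on, was not a hypothesis, and the `L`-side tower was dominated by "`K`-side tower +
  Arthur–Clozel".  Now Stub 4 is landed in LINKED form (`stub_baseChangeToL_linked`,
  `…BaseChangeToLLinked.lean`): `(L, s, c, hcptL, S_L)` depend on `(c₀, S', S₀)` only and EVERY member
  `(P, r)` has an unramified strong base-change lift `P_L` (`IsUnramifiedBaseChangeLift P P_L`) compatible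
  with `r|_{Γ_L}` off `S_L`, with the trace bound on `Γ_L`; the heart `stub_twoWallOrdinaryClassicalityOrd`
  (name kept, signature v2) takes this MAP in place of the anonymous `L`-tower, plus `S₀ ⊆ S_K` and `S_L ⊇ {w ∣ S_K}`.
  The v2 heart is a WEAKER theorem than c1's `TwoWallOrdinaryClassicalityOrdStmt` (strictly more
  hypotheses, same conclusion; still implied by reciprocity for `ρ'_C`), hence the better statement to
  promote.  `stub_baseChangeFacts`, 2⁰, 3ᵒʳᵈ, 5rem unchanged; five `sorry`s as before.

* RESHAPE r10 (continuation lead prover-line-stmt-Langlands-13758-c4-0, 2026-08-16): THE LINE'S VOCABULARY AND ITS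
  CONDITIONAL REDUCTION ARE IN THE BUILT TREE.  `ArtinData`, `IsAlignedWeight`, `MuOrdinaryGaloisGuard`,
  `OrdPolarizedTower` (and the interface shapes, the three open stub statements as the named propositions
  `OrdinaryPolarizedTwistedTowerDebt` / `TwoWallOrdinaryClassicalityLinked` / `BasicRemainder`, and the restated items
  `IrregularClassicalityOrd` / `MuOrdinaryFamilyRTOrd` / `BasicLocusAutomorphy` of the c1/c2 kit) now live ONCE in
  `Theorems/PicardMuOrdinaryIrregularClassicalityDefs.lean` (namespace of the landed stubs, `open`ed below), instead of
  three times in three workfile namespaces; the composition is the landed conditional theorem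
  `irregularClassicality_of_stubs` of `Theorems/PicardMuOrdinaryIrregularClassicalityReduction.lean` (the r9 script with
  its five `sorry`s as hypotheses; same file: `irregularClassicalityOrd_of` = the restate certificate, `closes_ord` =
  the re-route deciding theorem).  Stub names and signatures are byte-identical with r9; the skeleton keeps the r9
  script inline (independent of that module's build state); it is definitionally that one `exact`.

Disproof.lean (cycles 1–2) honoured: no `_false_without_` theorem exists (item 2); the tower is
USED (items 5/9/13: `stub_baseChangeToL` consumes every depth `k`, nothing stationary or of finite
eigensystem range is assumed); item 11/§7 (embedding may be fixed) is not even needed — the stubs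
are uniform in `e`; item 12/§6 (`S` enlarged freely: `S ∪ S₀ ⊆ S'`, `S_L ⊇` places above `S₀` and
`3`, `S₀ ⊇ {v ∣ 3}`); item 4 (normalisations: `N𝔭·Σα` for the regular `P_k`/`Π_k` via
`IsGaloisCompatibleAt` (`m = n = 3`), `Σα` with `m = 1` for the L-algebraic `π'_L`, `π_K`); item 6
(`u ∉ 𝔐 ∧ u t ∈ (3^k)` = `v_𝔐(t) ≥ k`, exactly the hypothesis shape of `stub_placeOfMaximalIdeal`);
item 7/17(a) isolated — and corrected by the twist — as `stub_polarizedTwistedTower`.  No stub is an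
instance of a landed Negative lemma (`Negative/StationaryCollapse`, `EmbeddingWLOG`,
`FiniteRangeCollapse` are positive partial results).
-/

open Literature.NumberTheory.GaloisRepresentations Literature.NumberTheory.Automorphic
open IsDedekindDomain NumberField Polynomial

set_option linter.dupNamespace false

noncomputable section

namespace Summit.Langlands.Langlands.Cruxes.IrregularClassicality.SplitRamifiedPrimeSqrt6

/-! ## Vocabulary
Reshape r10: `ArtinData`, `IsAlignedWeight`, `MuOrdinaryGaloisGuard`, `OrdPolarizedTower` are the tree's
(`Theorems/PicardMuOrdinaryIrregularClassicalityDefs.lean`, namespace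
`Summit.Langlands.Langlands.Theorems.IrregularClassicality.SplitRamifiedPrimeSqrt6`, opened here). -/

open Summit.Langlands.Langlands.Theorems.IrregularClassicality.SplitRamifiedPrimeSqrt6

/-! ## The stubs of reshape r6 -/

/-! **Stub 1 — `stub_placeOfMaximalIdeal` — LANDED** (p78785,
`Summits/Langlands/Langlands/Theorems/PicardMuOrdinaryIrregularClassicalityPlaceOfMaximalIdeal.lean`):
every maximal `𝔐 ∋ 3` of `ℤ̄ ⊂ ℂ` is the place of an isomorphism `ι : ℚ̄₃ ≃+* ℂ` with
`(∃ u ∉ 𝔐, u z ∈ (3^k)) → ‖ι⁻¹ z‖ ≤ 3^{-k}`. -/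

/-- **Stub 2⁰ — the Picard Galois representation (a NAMED FACT of the tree).**
`picardCurve_exists_lambdaAdicRep` (`Literature/NumberTheory/GaloisRepresentations/PicardCurveGaloisRep.lean`):
for every integer quartic `f` separable over `ℚ` and every `j : ℚ(ω) →+* ℚ̄₃`, an `ω`-eigenpart of
`H¹_ét(C_{f,K̄}, ℚ̄₃)` is a continuous `ρ_C : Γ_K → GL₃(ℚ̄₃)`, unramified with geometric-Frobenius trace
`j(a_𝔭(f))` wherever `𝔭 ∤ 3` and `f mod 𝔭` is a separable quartic, absolutely irreducible when
`12 ∣ #Gal(f)` [Upton 2009; Serre–Tate; SGA 4½; Zarhin 2018].  Discharging it = landing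
`picardCurve_exists_lambdaAdicRep_holds` in Literature (shared with 13757's `stub_picardFact`). -/
theorem stub_picardCurveGaloisRep :
    Literature.NumberTheory.GaloisRepresentations.picardCurve_exists_lambdaAdicRep := by
  sorry

/-! **Stub 2 — `stub_twistedPicardGaloisInput` — LANDED** (p92308,
`Summits/Langlands/Langlands/Theorems/PicardMuOrdinaryIrregularClassicalityTwistedPicardGaloisInput.lean`,
conditional exactly on Stub 2⁰): `S₀ ⊇ {v ∣ 3}`, primary generators `ϖ` off `S₀`, `ρ = ρ_C ⊗ ψ` through
`(ι, e)` unramified off `S₀` with geometric-Frobenius trace `ι⁻¹ e(a_𝔭(f)·ϖ_𝔭)`, absolutely irreducible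
on every quadratic `Γ_L`. -/

/-- **Stub 3ᵒʳᵈ — THE INTERFACE DEBT with its ORDINARY AVATAR, guarded** (reshape r6, guard ALIGNED in
r7; replaces r5's `stub_polarizedTwistedTower`).  For generic `f`, an isomorphism `ι` adapted to the place
`𝔐`, the twisted Picard representation `ρ = ρ'_C` through `(ι, e)` (Stub 2's output: primary generators
`ϖ` off `S₀`, trace identity), IF `ρ` is μ-ordinary at `λ` in the aligned sense (`MuOrdinaryGaloisGuard art
ρ`) and the typed slope-free tower of the crux hypothesis is given (`N𝔭·ΣSat(P_k,𝔭) ≡ e(a_𝔭 f)` modulo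
`3^k ℤ̄_𝔐` off `S`), THEN there are complex conjugation `c₀ ≠ 1`, a level `S' ⊇ S ∪ S₀` and an ORDINARY
exactly `c₀`-polarized tower for the twisted traces `e(a_𝔭(f)·ϖ_𝔭)` off `S'` relative to the same `art`
(`OrdPolarizedTower`): regular algebraic conjugate-self-dual `Π_k`, Galois-compatible off `S'` with an
`r_k` ordinary at `λ` of a dominant labelled weight, `‖ι⁻¹(N𝔭·ΣSat(Π_k,𝔭) − e(a_𝔭 ϖ_𝔭))‖ ≤ 3^{-k}`.
STATUS: exactly what 13757's intended `R^{μ-ord} = T` towers are (members of the μ-ordinary Hida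
family of `U(2,1)`, base-changed to `GL₃/K` and read through `ι`); as typed it does NOT follow from the
slope-free unpolarized tower (a `3`-adic automorphic `GL₃ → U(3)` descent plus an ordinarity statement
for a non-classical limit point — 13757-sized).  NOT to be staffed: it is discharged by the planner's
ORDINARY twisted-polarized restate of BOTH 13757's conclusion and 13758's hypothesis
(`Lines/split_ramified_prime_sqrt6_restated_ord.lean`, def `OrdTwistedPolarizedLimitHypothesis`), after
which it is the identity.  The ALIGNED guard keeps it TRUE-as-intended: it is the closure condition of the
avatars it must output (ordinary of DOMINANT weight, `muOrdinaryGaloisGuard_of_isDominant`), and it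
excludes the split-basic CM points (anchor `f₆₇`) that the r6 guard let through and at which no ordinary
dominant polarized tower is produced by any engine (CM towers through `ρ'_{C₆₇}` are anti-aligned).
Size: interface. -/
theorem stub_ordinaryPolarizedTwistedTower :
    ∀ (f : ℤ[X]) (hcpt : isCompact_glFiniteIntegralLevel 3 (CyclotomicField 3 ℚ)),
      f.natDegree = 4 → (f.map (Int.castRingHom ℚ)).Separable →
      12 ∣ Nat.card (f.map (Int.castRingHom ℚ)).Gal →
    ∀ (art : ArtinData) (ι : PadicAlgCl 3 ≃+* ℂ) (e : CyclotomicField 3 ℚ →+* ℂ)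
      (𝔐 : Ideal (integralClosure ℤ ℂ))
      (S S₀ : Finset (HeightOneSpectrum (𝓞 (CyclotomicField 3 ℚ))))
      (ϖ : HeightOneSpectrum (𝓞 (CyclotomicField 3 ℚ)) → 𝓞 (CyclotomicField 3 ℚ))
      (ρ : FramedGaloisRep (CyclotomicField 3 ℚ) (PadicAlgCl 3) 3),
      𝔐.IsMaximal → (3 : integralClosure ℤ ℂ) ∈ 𝔐 →
      (∀ (z : integralClosure ℤ ℂ) (k : ℕ),
        (∃ u : integralClosure ℤ ℂ, u ∉ 𝔐 ∧ u * z ∈ Ideal.span {(3 : integralClosure ℤ ℂ) ^ k}) →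
        ‖ι.symm (z : ℂ)‖ ≤ ((3 : ℝ)⁻¹) ^ k) →
      (∀ 𝔭 ∉ S₀,
        (𝔭.asIdeal = Ideal.span {ϖ 𝔭} ∧
          ϖ 𝔭 - 1 ∈ Ideal.span {(3 : 𝓞 (CyclotomicField 3 ℚ))}) ∧
        ρ.IsUnramifiedAt 𝔭 ∧
        ∀ 𝔓 ∈ 𝔭.primesAbove, ∀ τ : Field.absoluteGaloisGroup (CyclotomicField 3 ℚ),
          IsArithFrobAt (𝓞 (CyclotomicField 3 ℚ)) τ 𝔓 →
            FramedRep.trace ρ τ⁻¹ = ι.symm (e (↑(picardTrace f 𝔭 * ϖ 𝔭)))) →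
      MuOrdinaryGaloisGuard art ρ →
      (∀ k : ℕ, ∃ P : CuspidalAutomorphicRepData 3 (CyclotomicField 3 ℚ) hcpt,
        P.1.IsRegularAlgebraic ∧
        ∀ 𝔭 ∉ S, ∃ (α : Multiset ℂ) (t u : integralClosure ℤ ℂ), P.1.HasSatakeParamAt 𝔭 α ∧
          (t : ℂ) = (𝔭.residueCard : ℂ) * α.sum - e (picardTrace f 𝔭) ∧ u ∉ 𝔐 ∧
          u * t ∈ Ideal.span {(3 : integralClosure ℤ ℂ) ^ k}) →
    ∃ (c₀ : CyclotomicField 3 ℚ ≃ₐ[ℚ] CyclotomicField 3 ℚ)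
      (S' : Finset (HeightOneSpectrum (𝓞 (CyclotomicField 3 ℚ)))), c₀ ≠ 1 ∧ S ⊆ S' ∧ S₀ ⊆ S' ∧
      OrdPolarizedTower art hcpt ι c₀ S' (fun 𝔭 => e (↑(picardTrace f 𝔭 * ϖ 𝔭))) := by
  sorry

/-- **Stub 4⁰ — the base-change facts (NAMED FACTS of the tree; reshape r8: THREE, no longer four).**
Arthur–Clozel 1989 Thm. III.4.2 (a) (`baseChange_cyclic_cuspidal`), III.5.1 strong lift at unramified
places (`ArthurClozel1989_strongLifting_unramified`) and its archimedean clause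
(`ArthurClozel1989_strongLifting_archimedean`).  Harris–Lan–Taylor–Thorne / Scholze / Varma
(`exists_galoisRep_of_regularAlgebraic`, lang.S27) was the fourth conjunct up to r7; it only served to
attach Galois representations to the `P_k` over `K`, which the ordinary tower of Stub 3ᵒʳᵈ already
carries (its avatars `r_k`), so reshape r8 drops it.  Discharging this stub = landing the three `_holds`
theorems in Literature (literature-prover tasks shared with 13757; `BaseChangeCyclicCuspidalProofs`
is in progress in the tree). -/
theorem stub_baseChangeFacts :
    baseChange_cyclic_cuspidal ∧ ArthurClozel1989_strongLifting_unramified ∧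
      ArthurClozel1989_strongLifting_archimedean := by
  sorry

/-! **Stub 4 — `stub_baseChangeToL_linked` — LANDED in LINKED form** (reshape r9, lead c3;
`Summits/Langlands/Langlands/Theorems/PicardMuOrdinaryIrregularClassicalityBaseChangeToLLinked.lean`,
conditional exactly on the three named facts of Stub 4⁰): the base change to `L = K(√-2)` as a MAP on
tower members — the data `(L, s, c, hcptL, S_L)` depend only on `(c₀, S', S₀)`, and EVERY depth-`k`
member `(P, r)` of a polarized tower with avatars (in particular every member of the ordinary tower of
Stub 3ᵒʳᵈ) has an unramified strong base-change lift `P_L` (`IsUnramifiedBaseChangeLift P P_L`),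
regular algebraic, `c`-conjugate-self-dual, cuspidal, Galois-compatible with `r|_{Γ_L}` off `S_L`, with
`‖tr r|_{Γ_L} − tr ρ|_{Γ_L}‖ ≤ 3^{-k}` on `Γ_L`.  Earlier forms stay in the tree, unused by the
composition: r5 `stub_baseChangeToL` (p94426, `…BaseChangeToL.lean`: `𝔐`-currency, no avatars, HLTT
for the `r_k`) and r8 `stub_baseChangeToL_ord` (p105520, `…BaseChangeToLOrd.lean`: avatars, HLTT
dropped, but the `L`-side tower behind an `∃`, unlinked from the `K`-side members). -/

/-- **Stub 5ᵒʳᵈ — THE HEART in honest form: two-wall ORDINARY classicality, LINKED** (reshape r6, guard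
ALIGNED in r7, towers LINKED in r9).  Up to r8 the statement was VERBATIM lead c1's
`TwoWallOrdinaryClassicalityOrdStmt`: the `K`-side ordinary tower and the `L`-side Galois-convergent
tower as two INDEPENDENT hypotheses — so the one fact step (i) of the intended proof uses, "`Π_k` is the
base change of the ordinary member `P_k` and its Galois representation is `r_k|_{Γ_L}`, ordinary at
`u, ū ∣ 3` because `L_u = K_λ`", was not among the hypotheses (the `L`-side `r` was anonymous), and a
prover of the heart would have had to re-do the base change inside the open theorem.  Reshape r9 LINKS
them: the `L`-side hypothesis is now the base-change MAP of the landed `stub_baseChangeToL_linked` — for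
every depth `k` and every member `(P, r)` of the `K`-side currency (regular algebraic, `c₀`-conjugate
self-dual, Galois-compatible with `r` off `S_K`, `‖ι⁻¹(N𝔭·ΣSat(P,𝔭) − e(a_𝔭 ϖ_𝔭))‖ ≤ 3^{-k}` off `S_K`)
an unramified strong base-change lift `P_L` (`IsUnramifiedBaseChangeLift P P_L`), regular algebraic,
`c`-conjugate-self-dual cuspidal on `GL₃(𝔸_L)`, Galois-compatible with `r|_{Γ_L}` off `S_L ⊇ {w ∣ 3} ∪
{w ∣ S₀} ∪ {w ∣ S_K}`, with `‖tr r|_{Γ_L} − tr ρ|_{Γ_L}‖ ≤ 3^{-k}` (and `S₀ ⊆ S_K`) — a WEAKER theorem than c1's (more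
hypotheses, same conclusion, same truth status), and the honest input of BCGP's template.  That `λ`
SPLITS in `L` (`L_u = K_λ`, so `r_k|_{Γ_{L_u}}` is the ordinary `r_k|_{Γ_{K_λ}}`) is derivable from
`[L : K] = 2`, `s² = -2` and is LANDED as `lambda_splits_of_sq_eq_neg_two`
(`…IrregularClassicalityLambdaSplitsInL.lean`: every `w ∣ 3` of `L` has `e = f = 1` over `K`).
For generic `f`, `ι, e`, `S₀ ⊇ {v ∣ 3}`, primary generators `ϖ` off `S₀`, `ρ = ρ'_C = ρ_C ⊗ ψ`
(unramified off `S₀`, geometric-Frobenius trace `ι⁻¹ e(a_𝔭(f)·ϖ_𝔭)`; μ-ordinarity enters only through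
the avatars) — an ORDINARY `c₀`-polarized tower for these traces off `S_K` (`OrdPolarizedTower`: the
avatars `r_k` ordinary at `λ` of a dominant weight), the CM field `L = K(√-2)` (`s² = -2`, involution
`c`, `c|_K = c₀ ≠ 1`, `ρ|_{Γ_L}` absolutely irreducible, level `S_L`) and the base-change map of Stub 4
on members: THEN `ρ` is automorphic over `K` — a cuspidal `L`-algebraic `π'` on `GL₃(𝔸_K)` with
`ρ` unramified and of arithmetic-Frobenius characteristic polynomial `arithFrobPolyOfSatake ι q 1 α`
(`α` the Satake parameter of `π'`) at every `𝔭` off a finite `S'`.  Intended proof, on the unitary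
FOURFOLD of `G' = U(2,1)_{L/L⁺}` at `p = 3` (`L⁺ = ℚ(√6)`, `3` ramified in `L⁺` and SPLIT in `L/L⁺`,
`G'(ℚ₃) = GL₃(K_λ)`, smooth μ-ordinary-dense splitting model): (i) REALIZATION — the `Π_k` descend to
`G'` (Rogawski/Mok), are μ-ordinary of finite level at `u, ū` BY THE AVATARS (local–global
compatibility at `p` for regular conjugate-self-dual `Π_k`, Caraiani / BLGGT), so `λ'_{C,L}` is a
point of the μ-ordinary big Hecke algebra at tame level `S_L` and, by typicity (BCGP Lemma 276 /
Prop. ES-semisimple, Zariski closure `⊇ SL₃` for the non-CM Picard Jacobian), the `λ'_{C,L}`-part of the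
μ-ordinary higher-Hida `H⁰` of the singular weight has Galois structure `ρ|_{Γ_L} ⊗ W`; (ii) TWO-WALL
ORDINARY SEN = COUSIN (load-bearing, OPEN: BCGP 2025's announced extension to `p` not totally split,
arXiv:2502.20645 p. 3): `p`-adic Eichler–Shimura bi-filtration of the μ-ordinary locally analytic
completed cohomology for `Res_{K_λ/ℚ₃} GL₃`, `μ = ((1,0,0),(1,1,0))`, Sen components `Θ_{σ₁}, Θ_{σ₂}`
colliding `(0,0′)` with the incident cells `(1,0′)`, `(0,1′)`; `ρ|_{G_{L_u}}` de Rham ⇒ both Sen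
operators semisimple ⇒ the eigenclass dies under both Cousin maps ⇒ classical; (iii) multiplicity one of
`λ'_{C,L}`; (iv) Mok transfer `G' → GL₃/L` of the classical singular-weight form and SIGNED descent
`L → K` (the sign at primes inert in `L/K` from a Goldring–Koskivirta pseudo-representation over `K` at
an auxiliary good split prime compared with the `ℓ'`-adic companion of `ρ`, Chebotarev + Brauer–Nesbitt
+ Clifford + central characters).  TRUE whatever the hypotheses (implied by reciprocity for `ρ'_C`);
the hypotheses are what make (i)–(iv) a strategy.  THE ONE OPEN THEOREM of the line.  Size XL. -/
theorem stub_twoWallOrdinaryClassicalityOrd :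
    ∀ (art : ArtinData) (f : ℤ[X])
      (hcpt : isCompact_glFiniteIntegralLevel 3 (CyclotomicField 3 ℚ)),
      f.natDegree = 4 → (f.map (Int.castRingHom ℚ)).Separable →
      12 ∣ Nat.card (f.map (Int.castRingHom ℚ)).Gal →
    ∀ (ι : PadicAlgCl 3 ≃+* ℂ) (e : CyclotomicField 3 ℚ →+* ℂ)
      (S₀ : Finset (HeightOneSpectrum (𝓞 (CyclotomicField 3 ℚ))))
      (ϖ : HeightOneSpectrum (𝓞 (CyclotomicField 3 ℚ)) → 𝓞 (CyclotomicField 3 ℚ))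
      (ρ : FramedGaloisRep (CyclotomicField 3 ℚ) (PadicAlgCl 3) 3),
      (∀ v : HeightOneSpectrum (𝓞 (CyclotomicField 3 ℚ)),
        ((3 : ℕ) : 𝓞 (CyclotomicField 3 ℚ)) ∈ v.asIdeal → v ∈ S₀) →
      (∀ 𝔭 ∉ S₀,
        (𝔭.asIdeal = Ideal.span {ϖ 𝔭} ∧
          ϖ 𝔭 - 1 ∈ Ideal.span {(3 : 𝓞 (CyclotomicField 3 ℚ))}) ∧
        ρ.IsUnramifiedAt 𝔭 ∧
        ∀ 𝔓 ∈ 𝔭.primesAbove, ∀ τ : Field.absoluteGaloisGroup (CyclotomicField 3 ℚ),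
          IsArithFrobAt (𝓞 (CyclotomicField 3 ℚ)) τ 𝔓 →
            FramedRep.trace ρ τ⁻¹ = ι.symm (e (↑(picardTrace f 𝔭 * ϖ 𝔭)))) →
    ∀ (c₀ : CyclotomicField 3 ℚ ≃ₐ[ℚ] CyclotomicField 3 ℚ)
      (S_K : Finset (HeightOneSpectrum (𝓞 (CyclotomicField 3 ℚ)))),
      OrdPolarizedTower art hcpt ι c₀ S_K (fun 𝔭 => e (↑(picardTrace f 𝔭 * ϖ 𝔭))) → S₀ ⊆ S_K →
    ∀ (L : Type) [Field L] [NumberField L] [Algebra (CyclotomicField 3 ℚ) L]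
      (s : L) (c : L ≃ₐ[ℚ] L)
      (hcptL : isCompact_glFiniteIntegralLevel 3 L) (S_L : Finset (HeightOneSpectrum (𝓞 L))),
      NumberField.IsCMField L → c₀ ≠ 1 → s ^ 2 = -2 → Module.finrank (CyclotomicField 3 ℚ) L = 2 →
      c s = -s →
      (∀ x : CyclotomicField 3 ℚ,
        c (algebraMap (CyclotomicField 3 ℚ) L x) = algebraMap (CyclotomicField 3 ℚ) L (c₀ x)) →
      FramedRep.IsAbsolutelyIrreducible (ρ.restrictField L) →
      (∀ w : HeightOneSpectrum (𝓞 L), ((3 : ℕ) : 𝓞 L) ∈ w.asIdeal → w ∈ S_L) →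
      (∀ w : HeightOneSpectrum (𝓞 L), w.under (𝓞 (CyclotomicField 3 ℚ)) ∈ S₀ → w ∈ S_L) →
      (∀ w : HeightOneSpectrum (𝓞 L), w.under (𝓞 (CyclotomicField 3 ℚ)) ∈ S_K → w ∈ S_L) →
      (∀ (k : ℕ) (P : CuspidalAutomorphicRepData 3 (CyclotomicField 3 ℚ) hcpt)
        (r : FramedGaloisRep (CyclotomicField 3 ℚ) (PadicAlgCl 3) 3),
        P.1.IsRegularAlgebraic → P.1.IsConjSelfDualAE c₀ →
        (∀ 𝔭 ∉ S_K, IsGaloisCompatibleAt P.1 ι r 𝔭 ∧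
          ∃ (α : Multiset ℂ) (t : integralClosure ℤ ℂ), P.1.HasSatakeParamAt 𝔭 α ∧
            (t : ℂ) = (𝔭.residueCard : ℂ) * α.sum - e (↑(picardTrace f 𝔭 * ϖ 𝔭)) ∧
            ‖ι.symm (t : ℂ)‖ ≤ ((3 : ℝ)⁻¹) ^ k) →
        ∃ P_L : CuspidalAutomorphicRepData 3 L hcptL,
          P_L.1.IsRegularAlgebraic ∧ P_L.1.IsConjSelfDualAE c ∧
          IsUnramifiedBaseChangeLift P.1 P_L.1 ∧
          (∀ w ∉ S_L, P_L.1.IsUnramifiedAt w ∧ IsGaloisCompatibleAt P_L.1 ι (r.restrictField L) w) ∧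
          ∀ g : Field.absoluteGaloisGroup L,
            ‖FramedRep.trace (r.restrictField L) g - FramedRep.trace (ρ.restrictField L) g‖ ≤
              ((3 : ℝ)⁻¹) ^ k) →
    ∃ (π' : CuspidalAutomorphicRepData 3 (CyclotomicField 3 ℚ) hcpt)
      (S' : Finset (HeightOneSpectrum (𝓞 (CyclotomicField 3 ℚ)))),
      π'.1.IsLAlgebraic ∧
      ∀ 𝔭 ∉ S', ∃ α : Multiset ℂ, π'.1.HasSatakeParamAt 𝔭 α ∧
        ρ.IsUnramifiedAt 𝔭 ∧ ρ.HasFrobCharpolyAt 𝔭 (arithFrobPolyOfSatake ι 𝔭.residueCard 1 α) := by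
  sorry

/-- **Stub 5rem — the conceded λ-BASIC remainder** (reshape r6, guard ALIGNED in r7).  For generic `f`,
`ι` adapted to the place `𝔐`, `ρ = ρ'_C` through `(ι, e)` (Stub 2's output) which is ordinary of an
ALIGNED labelled weight at `λ` for NO local Artin datum (the negation of the aligned guard over all
`art`: `ρ_C` λ-basic — every `f` whose CURVE has potentially good reduction at `3` (Börner–Bouw–Wewers
2017 §3.2: special fibre `y³ − y = x⁴`, supersingular) and the split-basic CM points such as the anchor
`f₆₇` (anti-aligned flags only); the potentially multiplicative types now sit on the guarded side), and
the typed slope-free tower of the crux hypothesis: the `K`-side automorphy conclusion of the heart.  TRUE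
under reciprocity; NO mechanism in print or announced (no ordinary/finite-slope structure at the
ramified, rank-one prime; Pan-style slope-free Sen theory exists for the modular curve only; the CM
corner is automorphic induction, Disproof item 20 (a)) — crux-sized, CONCEDED, not to be staffed.
Under the ordinary restate it leaves this item: the aligned guard becomes a hypothesis of 13757 and the
basic class a separately filed crux / third branch of the route (`BasicLocusAutomorphy`). -/
theorem stub_basicRemainder :
    ∀ (f : ℤ[X]) (hcpt : isCompact_glFiniteIntegralLevel 3 (CyclotomicField 3 ℚ)),
      f.natDegree = 4 → (f.map (Int.castRingHom ℚ)).Separable →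
      12 ∣ Nat.card (f.map (Int.castRingHom ℚ)).Gal →
    ∀ (ι : PadicAlgCl 3 ≃+* ℂ) (e : CyclotomicField 3 ℚ →+* ℂ)
      (S₀ : Finset (HeightOneSpectrum (𝓞 (CyclotomicField 3 ℚ))))
      (ϖ : HeightOneSpectrum (𝓞 (CyclotomicField 3 ℚ)) → 𝓞 (CyclotomicField 3 ℚ))
      (ρ : FramedGaloisRep (CyclotomicField 3 ℚ) (PadicAlgCl 3) 3),
      (∀ v : HeightOneSpectrum (𝓞 (CyclotomicField 3 ℚ)),
        ((3 : ℕ) : 𝓞 (CyclotomicField 3 ℚ)) ∈ v.asIdeal → v ∈ S₀) →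
      (∀ 𝔭 ∉ S₀,
        (𝔭.asIdeal = Ideal.span {ϖ 𝔭} ∧
          ϖ 𝔭 - 1 ∈ Ideal.span {(3 : 𝓞 (CyclotomicField 3 ℚ))}) ∧
        ρ.IsUnramifiedAt 𝔭 ∧
        ∀ 𝔓 ∈ 𝔭.primesAbove, ∀ τ : Field.absoluteGaloisGroup (CyclotomicField 3 ℚ),
          IsArithFrobAt (𝓞 (CyclotomicField 3 ℚ)) τ 𝔓 →
            FramedRep.trace ρ τ⁻¹ = ι.symm (e (↑(picardTrace f 𝔭 * ϖ 𝔭)))) →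
      (∀ art : ArtinData, ¬ MuOrdinaryGaloisGuard art ρ) →
    ∀ (𝔐 : Ideal (integralClosure ℤ ℂ)) (S : Finset (HeightOneSpectrum (𝓞 (CyclotomicField 3 ℚ)))),
      𝔐.IsMaximal → (3 : integralClosure ℤ ℂ) ∈ 𝔐 →
      (∀ (z : integralClosure ℤ ℂ) (k : ℕ),
        (∃ u : integralClosure ℤ ℂ, u ∉ 𝔐 ∧ u * z ∈ Ideal.span {(3 : integralClosure ℤ ℂ) ^ k}) →
        ‖ι.symm (z : ℂ)‖ ≤ ((3 : ℝ)⁻¹) ^ k) →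
      (∀ k : ℕ, ∃ P : CuspidalAutomorphicRepData 3 (CyclotomicField 3 ℚ) hcpt,
        P.1.IsRegularAlgebraic ∧
        ∀ 𝔭 ∉ S, ∃ (α : Multiset ℂ) (t u : integralClosure ℤ ℂ), P.1.HasSatakeParamAt 𝔭 α ∧
          (t : ℂ) = (𝔭.residueCard : ℂ) * α.sum - e (picardTrace f 𝔭) ∧ u ∉ 𝔐 ∧
          u * t ∈ Ideal.span {(3 : integralClosure ℤ ℂ) ^ k}) →
    ∃ (π' : CuspidalAutomorphicRepData 3 (CyclotomicField 3 ℚ) hcpt)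
      (S' : Finset (HeightOneSpectrum (𝓞 (CyclotomicField 3 ℚ)))),
      π'.1.IsLAlgebraic ∧
      ∀ 𝔭 ∉ S', ∃ α : Multiset ℂ, π'.1.HasSatakeParamAt 𝔭 α ∧
        ρ.IsUnramifiedAt 𝔭 ∧ ρ.HasFrobCharpolyAt 𝔭 (arithFrobPolyOfSatake ι 𝔭.residueCard 1 α) := by
  sorry

/-! **Stub 6 — `stub_irregularDescentUntwist` — LANDED** (p94413,
`Summits/Langlands/Langlands/Theorems/PicardMuOrdinaryIrregularClassicalityIrregularDescentUntwist.lean`,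
UNCONDITIONAL): a cuspidal L-algebraic `π'` on `GL₃(𝔸_K)` compatible a.e. over `K` with `ρ = ρ'_C`
untwists by `ψ⁻¹` to a cuspidal L-algebraic `π_K` with `Σ Sat(π_K, 𝔭) = e(a_𝔭 f)` a.e. -/


/-! ## The composition: the stubs imply the crux, by name -/

/-- **The line concludes the crux** (reshape r10: by the landed conditional reduction).  Unpack the typed tower
`(e, 𝔐, S, (P_k))`; Stub 1 (landed) turns `𝔐` into an adapted `ι : ℚ̄₃ ≃ ℂ`; Stub 2 (landed, on the Picard fact 2⁰)
gives the primary generators `ϖ` off `S₀ ⊇ {v ∣ 3}` and `ρ = ρ'_C` through `(ι, e)`; CASE SPLIT on the ALIGNED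
μ-ordinarity of `ρ` (`∃ art, MuOrdinaryGaloisGuard art ρ`).  μ-ORDINARY: Stub 3ᵒʳᵈ (interface debt) produces the
ordinary exactly polarized tower with its avatars; Stub 4 (landed in linked form, r9, on the three Arthur–Clozel facts
4⁰) supplies `L = K(√-2)`, the level `S_L` and the base-change MAP on tower members; Stub 5ᵒʳᵈ (the heart, fed the
ordinary tower AND the map) makes `ρ` automorphic over `K`.  λ-BASIC: Stub 5rem (conceded).  In both cases Stub 6
(landed) untwists to a cuspidal L-algebraic `π_K` with `ΣSat(π_K,𝔭) = e(a_𝔭(f))` a.e.  This script is landed verbatim as the conditional theorem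
`irregularClassicality_of_stubs` (`Theorems/PicardMuOrdinaryIrregularClassicalityReduction.lean`, p126473); the only
`sorry`s are inside the five stubs. -/
theorem IrregularClassicality_of :
    Summit.Langlands.Langlands.Theses.PicardMuOrdinary.IrregularClassicality := by
  -- = `irregularClassicality_of_stubs stub_picardCurveGaloisRep stub_baseChangeFacts.1 stub_baseChangeFacts.2.1
  --    stub_baseChangeFacts.2.2 stub_ordinaryPolarizedTwistedTower stub_twoWallOrdinaryClassicalityOrd stub_basicRemainder`
  -- (landed, `Theorems/PicardMuOrdinaryIrregularClassicalityReduction.lean`, p126473); the script is kept inline so that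
  -- the skeleton elaborates independently of that module's build state.
  intro f hcpt hdeg hsep hgal hlim
  classical
  obtain ⟨e, 𝔐, S, h𝔐, h3, htower⟩ := hlim
  -- Stub 1 (landed): the place 𝔐 is the place of an isomorphism ι : ℚ̄₃ ≃ ℂ
  obtain ⟨ι, hι⟩ := stub_placeOfMaximalIdeal 𝔐 h𝔐 h3
  -- Stub 2 (landed, on 2⁰): primary generators and the twisted Picard representation through (ι, e)
  obtain ⟨S₀, ϖ, ρ, hS₀, hirr, hρ⟩ := stub_twistedPicardGaloisInput stub_picardCurveGaloisRep f hdeg hsep hgal ι e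
  -- Stub 4⁰: the named facts (Arthur–Clozel ×3)
  obtain ⟨hBCc, hBCu, hBCa⟩ := stub_baseChangeFacts
  -- case split on the μ-ordinarity of ρ at λ
  by_cases hg : ∃ art : ArtinData, MuOrdinaryGaloisGuard art ρ
  · obtain ⟨art, hg⟩ := hg
    -- Stub 3ᵒʳᵈ: the interface debt — the ORDINARY exactly polarized tower for the twisted traces
    obtain ⟨c₀, S', hc₀, -, hS₀S', hord⟩ :=
      stub_ordinaryPolarizedTwistedTower f hcpt hdeg hsep hgal art ι e 𝔐 S S₀ ϖ ρ h𝔐 h3 hι hρ hg htower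
    -- Stub 4 (linked form, landed r9): the base change to L = K(√-2) as a map on tower members
    obtain ⟨L, _instF, _instNF, _instA, s, c, hcptL, S_L, hCM, hs, hdegL, hcs, hcc₀, hSL3, hSLS₀, hSLS, hBCmap⟩ :=
      stub_baseChangeToL_linked hBCc hBCu hBCa ι hcpt c₀ hc₀ S' S₀
        (fun 𝔭 => e (↑(picardTrace f 𝔭 * ϖ 𝔭))) ρ hS₀ (fun 𝔭 h𝔭 => (hρ 𝔭 h𝔭).2)
    -- Stub 5ᵒʳᵈ: the heart — ρ is automorphic over K
    obtain ⟨π', S'', hLalg, hcompat⟩ :=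
      stub_twoWallOrdinaryClassicalityOrd art f hcpt hdeg hsep hgal ι e S₀ ϖ ρ hS₀ hρ c₀ S' hord hS₀S'
        L s c hcptL S_L hCM hc₀ hs hdegL hcs hcc₀ (hirr L hdegL) hSL3 hSLS₀ hSLS hBCmap
    -- Stub 6 (landed): untwist, in sum form
    obtain ⟨πK, hKalg, hev⟩ :=
      stub_irregularDescentUntwist f hcpt hdeg hsep hgal ι e S₀ ϖ ρ hS₀ hρ π' S'' hLalg hcompat
    exact ⟨e, πK, hKalg, hev⟩
  · push Not at hg
    -- Stub 5rem: the conceded λ-basic remainder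
    obtain ⟨π', S'', hLalg, hcompat⟩ :=
      stub_basicRemainder f hcpt hdeg hsep hgal ι e S₀ ϖ ρ hS₀ hρ hg 𝔐 S h𝔐 h3 hι htower
    -- Stub 6 (landed): untwist, in sum form
    obtain ⟨πK, hKalg, hev⟩ :=
      stub_irregularDescentUntwist f hcpt hdeg hsep hgal ι e S₀ ϖ ρ hS₀ hρ π' S'' hLalg hcompat
    exact ⟨e, πK, hKalg, hev⟩

end Summit.Langlands.Langlands.Cruxes.IrregularClassicality.SplitRamifiedPrimeSqrt6

end
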